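import Summits.CriticalPhenomena.SAWScalingLimit.Theorems.AvoidanceLimit.Negative.AvoidanceLimitWitnessDomains

/-!
# Negative knowledge on crux `AvoidanceLimit`, part 4: the restriction data are load-bearing

Support file (refuter / cdisprove lane) for the crux
`Summit.CriticalPhenomena.SAWScalingLimit.Theses.SAWLoopFugacityFlow.AvoidanceLimit`
(stmt-CriticalPhenomena-10649, route SAWLoopFugacityFlow, rank 2): for every Dobrushin domain
`(D; a, b)`, hull subdomain `D'`, endpoint approximation, chordal uniformizer `φ`, pulled-back hull
`A = closure (ℍ ∖ φ⁻¹ D')` and restriction data `(Φ, d = Φ'_A(0))`,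
`P_δ(range γ_δ ⊆ closure D') → d^(5/8)` as `δ → 0+`. The crux itself is NOT refuted (it follows from
`SAWScalingLimit`; LSW04 Prediction 1 on avoidance marginals); the `Negative/` files record, as
kernel-checked theorems, which hypotheses any proof MUST use: each variant is the crux with ONE
hypothesis dropped or weakened, everything else verbatim, and each is FALSE.

* **`avoidanceLimit_false_without_normalisation`** — weaken `IsRestrictionMap A Φ` to `Φ(0) = 0`
  (drop `Φ(z)/z → 1` at `∞`): with `D' = D`, `A = ∅`, both `id` (`d = 1`) and `2·id` (`d = 2`)
  qualify, forcing `1 = 2^(5/8)`.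
* **`avoidanceLimit_false_without_deriv`** — drop `HasRestrictionDeriv A Φ d`: `d` is free.
* **`avoidanceLimit_false_without_hullEq`** — drop the identification
  `A = closure (ℍ ∖ φ⁻¹ D')`: take `A = B(3i,1)ᶜ`, so `ℍ ∖ A` is a disc (away from `0`, bounded) and
  any of its Riemann maps is a "restriction map" with every `d`.
Moral: `d` is meaningful only as the derivative at `0` of THE hydrodynamically normalised map of THE
pulled-back hull. [folklore]
-/

noncomputable section

open Set Filter Topology MeasureTheory Complex Metric
open UpperHalfPlane (upperHalfPlaneSet isOpen_upperHalfPlaneSet)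
open Literature.Probability.RandomPlanarGeometry Literature.Probability.LatticeModels
open Summit.CriticalPhenomena.SAWScalingLimit.Theses.SAWLoopFugacityFlow (AvoidanceLimit)

namespace Summit.CriticalPhenomena.SAWScalingLimit.Theorems.AvoidanceLimit.Negative

/-! ### (a) Load-bearing hypothesis: the hydrodynamic normalisation `Φ(z)/z → 1` at `∞` -/

/-- The crux with `IsRestrictionMap A Φ` WEAKENED to its first clause `Φ(0) = 0`
(`Φ.HasBoundaryValue 0 0`); the normalisation `Φ(z)/z → 1` at `∞` is dropped. -/
def AvoidanceLimitWithoutNormalisation : Prop :=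
  ∀ (D D' : DobrushinDomain) (a b : ℝ → Site 2), SAW.IsEndpointApprox D a b →
    D'.carrier ⊆ D.carrier → D'.pt 0 = D.pt 0 → D'.pt 1 = D.pt 1 →
    (∃ ε : ℝ, 0 < ε ∧ D'.carrier ∩ Metric.ball (D.pt 0) ε = D.carrier ∩ Metric.ball (D.pt 0) ε ∧
      D'.carrier ∩ Metric.ball (D.pt 1) ε = D.carrier ∩ Metric.ball (D.pt 1) ε) →
    ∀ (φ : ConformalEquiv upperHalfPlaneSet D.carrier), D.IsChordalUniformizing φ →
    ∀ (A : Set ℂ), A = closure (upperHalfPlaneSet \ {z | z ∈ upperHalfPlaneSet ∧ φ z ∈ D'.carrier}) →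
    ∀ (Φ : ConformalEquiv (upperHalfPlaneSet \ A) upperHalfPlaneSet) (d : ℝ),
      Φ.HasBoundaryValue 0 0 → HasRestrictionDeriv A Φ d →
      Tendsto (fun δ => ((SAW.law D.carrier δ (a δ) (b δ)).map (fun γ => γ.curve))
        (CurveClass.rangeSubset (closure D'.carrier))) (𝓝[>] 0)
        (𝓝 (ENNReal.ofReal (d ^ ((5 : ℝ) / 8))))

/-- The dilation `z ↦ 2z` viewed as a conformal equivalence `ℍ ∖ ∅ → ℍ`. [folklore] -/
def dilationTwo : ConformalEquiv (upperHalfPlaneSet \ ∅) upperHalfPlaneSet :=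
  (ConformalEquiv.smulUpperHalfPlane 2 two_pos).copy _ _ sdiff_empty rfl

/-- The dilation acts as `z ↦ 2z`. [folklore] -/
@[simp] theorem dilationTwo_apply (z : ℂ) : dilationTwo z = (2 : ℝ) • z := rfl

/-- The dilation fixes the boundary point `0`. [folklore] -/
theorem dilationTwo_hasBoundaryValue : dilationTwo.HasBoundaryValue 0 0 := by
  show Tendsto (fun z : ℂ ↦ dilationTwo z) _ _
  simp only [dilationTwo_apply]
  exact ((continuous_const_smul (2 : ℝ)).tendsto' (0 : ℂ) 0 (smul_zero _)).mono_left
    nhdsWithin_le_nhds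

/-- `Φ'(0) = 2` for the dilation. [folklore] -/
theorem dilationTwo_hasRestrictionDeriv : HasRestrictionDeriv ∅ dilationTwo 2 := by
  unfold HasRestrictionDeriv
  simp only [dilationTwo_apply]
  refine (tendsto_const_nhds (x := ((2 : ℝ) : ℂ))).congr' ?_
  filter_upwards [self_mem_nhdsWithin] with z hz
  have hz0 : z ≠ 0 := by
    rintro rfl
    exact absurd hz.1 (by simp [upperHalfPlaneSet])
  rw [Complex.real_smul, mul_div_assoc, div_self hz0, mul_one]

/-- **The normalisation at `∞` is load-bearing.** Witness: `D' = D = bigSq`, `A = ∅`; both `id`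
(`d = 1`) and `2·id` (`d = 2`) fix `0`, so the conclusion would give `1 = 2^(5/8)`.
Moral: `d = Φ'_A(0)` is only meaningful once the scale of `Φ_A` is pinned at `∞`. [folklore] -/
theorem avoidanceLimit_false_without_normalisation : ¬ AvoidanceLimitWithoutNormalisation := by
  intro h
  obtain ⟨a, b, hab⟩ := SAW.exists_isEndpointApprox bigSq
  obtain ⟨φ, hφ⟩ := MarkedDomain.exists_isChordalUniformizing_holds bigSq
  have key := h bigSq bigSq a b hab subset_rfl rfl rfl ⟨1, one_pos, rfl, rfl⟩ φ hφ
    ∅ (empty_eq_pullback_self φ)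
  have h1 := key restrictionMapEmpty 1 isRestrictionMap_empty.1 hasRestrictionDeriv_empty
  have h2 := key dilationTwo 2 dilationTwo_hasBoundaryValue dilationTwo_hasRestrictionDeriv
  have heq := limit_unique h2 h1
  rw [Real.one_rpow, ENNReal.ofReal_one, ENNReal.ofReal_eq_one] at heq
  have hlt : (1 : ℝ) < 2 ^ ((5 : ℝ) / 8) := Real.one_lt_rpow (by norm_num) (by norm_num)
  exact hlt.ne' heq

/-! ### (a) Load-bearing hypothesis: the derivative clause `HasRestrictionDeriv A Φ d` -/

/-- The crux with the clause `HasRestrictionDeriv A Φ d` DROPPED (so `d` is unconstrained). -/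
def AvoidanceLimitWithoutDeriv : Prop :=
  ∀ (D D' : DobrushinDomain) (a b : ℝ → Site 2), SAW.IsEndpointApprox D a b →
    D'.carrier ⊆ D.carrier → D'.pt 0 = D.pt 0 → D'.pt 1 = D.pt 1 →
    (∃ ε : ℝ, 0 < ε ∧ D'.carrier ∩ Metric.ball (D.pt 0) ε = D.carrier ∩ Metric.ball (D.pt 0) ε ∧
      D'.carrier ∩ Metric.ball (D.pt 1) ε = D.carrier ∩ Metric.ball (D.pt 1) ε) →
    ∀ (φ : ConformalEquiv upperHalfPlaneSet D.carrier), D.IsChordalUniformizing φ →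
    ∀ (A : Set ℂ), A = closure (upperHalfPlaneSet \ {z | z ∈ upperHalfPlaneSet ∧ φ z ∈ D'.carrier}) →
    ∀ (Φ : ConformalEquiv (upperHalfPlaneSet \ A) upperHalfPlaneSet) (d : ℝ),
      IsRestrictionMap A Φ →
      Tendsto (fun δ => ((SAW.law D.carrier δ (a δ) (b δ)).map (fun γ => γ.curve))
        (CurveClass.rangeSubset (closure D'.carrier))) (𝓝[>] 0)
        (𝓝 (ENNReal.ofReal (d ^ ((5 : ℝ) / 8))))

/-- **The derivative clause is load-bearing** (trivially: it is the only link between `d` and `Φ`).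
Witness `D' = D = bigSq`, `A = ∅`, `Φ = id`, `d ∈ {0, 1}`. [folklore] -/
theorem avoidanceLimit_false_without_deriv : ¬ AvoidanceLimitWithoutDeriv := by
  intro h
  obtain ⟨a, b, hab⟩ := SAW.exists_isEndpointApprox bigSq
  obtain ⟨φ, hφ⟩ := MarkedDomain.exists_isChordalUniformizing_holds bigSq
  have key := h bigSq bigSq a b hab subset_rfl rfl rfl ⟨1, one_pos, rfl, rfl⟩ φ hφ
    ∅ (empty_eq_pullback_self φ) restrictionMapEmpty
  exact one_ne_zero_rpow (limit_unique (key 1 isRestrictionMap_empty) (key 0 isRestrictionMap_empty))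

/-! ### (a) Load-bearing hypothesis: the identification `A = closure (ℍ ∖ φ⁻¹ D')` -/

/-- The crux with the identification `A = closure (ℍ ∖ φ⁻¹(D'))` DROPPED (`A` is a free set). -/
def AvoidanceLimitWithoutHullEq : Prop :=
  ∀ (D D' : DobrushinDomain) (a b : ℝ → Site 2), SAW.IsEndpointApprox D a b →
    D'.carrier ⊆ D.carrier → D'.pt 0 = D.pt 0 → D'.pt 1 = D.pt 1 →
    (∃ ε : ℝ, 0 < ε ∧ D'.carrier ∩ Metric.ball (D.pt 0) ε = D.carrier ∩ Metric.ball (D.pt 0) ε ∧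
      D'.carrier ∩ Metric.ball (D.pt 1) ε = D.carrier ∩ Metric.ball (D.pt 1) ε) →
    ∀ (φ : ConformalEquiv upperHalfPlaneSet D.carrier), D.IsChordalUniformizing φ →
    ∀ (A : Set ℂ),
    ∀ (Φ : ConformalEquiv (upperHalfPlaneSet \ A) upperHalfPlaneSet) (d : ℝ),
      IsRestrictionMap A Φ → HasRestrictionDeriv A Φ d →
      Tendsto (fun δ => ((SAW.law D.carrier δ (a δ) (b δ)).map (fun γ => γ.curve))
        (CurveClass.rangeSubset (closure D'.carrier))) (𝓝[>] 0)
        (𝓝 (ENNReal.ofReal (d ^ ((5 : ℝ) / 8))))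

/-- The disc `B(3i, 1)` lies in the open upper half-plane. [folklore] -/
theorem ball_three_I_subset : ball (3 * I) 1 ⊆ upperHalfPlaneSet := by
  intro z hz
  rw [Metric.mem_ball, dist_eq_norm] at hz
  have h := Complex.abs_im_le_norm (z - 3 * I)
  simp only [Complex.sub_im, Complex.mul_im, Complex.I_im, Complex.re_ofNat, Complex.im_ofNat,
    Complex.I_re] at h
  show (0 : ℝ) < z.im
  have := (abs_le.1 (h.trans hz.le)).1
  linarith

/-- **The identification of `A` with the pulled-back hull is load-bearing.** Witness: `D' = D`,
`A = B(3i,1)ᶜ` (so `ℍ ∖ A` is a disc, away from `0` and bounded): any Riemann map of the disc is a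
"restriction map" with every `d`. [folklore] -/
theorem avoidanceLimit_false_without_hullEq : ¬ AvoidanceLimitWithoutHullEq := by
  intro h
  obtain ⟨a, b, hab⟩ := SAW.exists_isEndpointApprox bigSq
  obtain ⟨φ, hφ⟩ := MarkedDomain.exists_isChordalUniformizing_holds bigSq
  set A : Set ℂ := (ball (3 * I) 1)ᶜ with hA
  have hUA : upperHalfPlaneSet \ A = ball (3 * I) 1 := by
    ext z
    simp only [hA, Set.mem_sdiff, mem_compl_iff, not_not]
    exact ⟨fun hz ↦ hz.2, fun hz ↦ ⟨ball_three_I_subset hz, hz⟩⟩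
  have key := h bigSq bigSq a b hab subset_rfl rfl rfl ⟨1, one_pos, rfl, rfl⟩ φ hφ A
  -- a Riemann map of the disc
  have hsc : IsSimplyConnected (ball (3 * I) 1) := by
    have : ContractibleSpace (ball (3 * I) 1) :=
      (convex_ball (3 * I) 1).contractibleSpace ⟨3 * I, mem_ball_self one_pos⟩
    change SimplyConnectedSpace (ball (3 * I) 1)
    infer_instance
  have hne : ball (3 * I) 1 ≠ univ := fun heq ↦ by
    have : (0 : ℂ) ∈ ball (3 * I) 1 := by rw [heq]; exact mem_univ _
    rw [Metric.mem_ball, dist_eq_norm, zero_sub, norm_neg, norm_mul, Complex.norm_I] at this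
    norm_num at this
  obtain ⟨Ψ⟩ := exists_conformalEquiv_upperHalfPlaneSet_holds isOpen_ball hsc hne
  set Φ : ConformalEquiv (upperHalfPlaneSet \ A) upperHalfPlaneSet := Ψ.symm.copy _ _ hUA rfl with hΦ
  have hbot0 : 𝓝[upperHalfPlaneSet \ A] (0 : ℂ) = ⊥ := by
    rw [hUA, ← Filter.not_neBot, ← mem_closure_iff_nhdsWithin_neBot, closure_ball _ one_ne_zero,
      Metric.mem_closedBall, dist_eq_norm, zero_sub, norm_neg, norm_mul, Complex.norm_I]
    norm_num
  have hbotInf : cocompact ℂ ⊓ 𝓟 (upperHalfPlaneSet \ A) = ⊥ := by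
    rw [hUA, Filter.inf_principal_eq_bot]
    exact mem_of_superset (isCompact_closedBall (3 * I) 1).compl_mem_cocompact
      (compl_subset_compl.2 ball_subset_closedBall)
  have hR : IsRestrictionMap A Φ := by
    refine ⟨?_, ?_⟩
    · show Tendsto Φ (𝓝[upperHalfPlaneSet \ A] 0) (𝓝 0)
      rw [hbot0]; exact tendsto_bot
    · rw [hbotInf]; exact tendsto_bot
  have hD : ∀ d : ℝ, HasRestrictionDeriv A Φ d := fun d ↦ by
    show Tendsto _ (𝓝[upperHalfPlaneSet \ A] 0) _
    rw [hbot0]; exact tendsto_bot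
  exact one_ne_zero_rpow (limit_unique (key Φ 1 hR (hD 1)) (key Φ 0 hR (hD 0)))


end Summit.CriticalPhenomena.SAWScalingLimit.Theorems.AvoidanceLimit.Negative

end
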